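import Literature.MathematicalPhysics.QuantumFieldTheory.Balaban1983to89.B9Eq349ConjugatedProjectionDifferenceSqrtKappa
import Literature.MathematicalPhysics.QuantumFieldTheory.Balaban1983to89.B9Eq349ConjugatedDPChain

/-!
# `Balaban1983to89.B9Eq349ConjugatedProjectionDifferenceChain` — T. Bałaban, *Propagators for lattice gauge theories in a background field*, Commun.
# Math. Phys. **99** (1985) 389–434 [Balaban1985BackgroundPropagators] (3.21)∕(3.25) p. 394, (3.49) p. 399, Thm 3.2 (3.48) p. 398, Thm 3.11 p. 416: **THE
# LETTER `dR` OF ROAD ΔA-CT AT THE CHAIN — `‖S R(U) S⁻¹ x − R(U)x‖ ≤ (15·s_A·β∕√κ₁)·‖x‖`**, `s_A = 4∕γ + M(4∕γ)²(3 + a′(2M+1))`: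
# `B9Eq349ConjugatedProjectionDifferenceSqrtKappa.norm_conjCompl_sub_compl_le` (t4-ne9-idea-1 g141's kernel C) with EVERY letter discharged exactly as
# ne9-leaf-06's `B9Eq349ConjugatedDPChain.norm_conjProj_chain_le_two` discharges those of `norm_conjProj_le_two` (`δ± = β·s_A` by `norm_Ap_sub_A_le` ∕
# `norm_Am_sub_A_le`, `P_M`∕`P_N` by `exists_range_proj`, the four unconjugated letters by `B9Eq349ConjugatedProjectionChain` §1); displayed: `γ`, `κ₁`, `M`,
# `β ≤ 1` over the (I4) letters, windows `3(1+a′)β² ≤ γ∕4`, `12·s_A·β ≤ √κ₁`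

statement-level skeleton of published theorems with citation tags; proofs where landed; nothing here is a claim about the Yang–Mills mass gap

CITATION HEADER (lean-in-tree rule).  Audit cell `pub-balaban`, sub-cell `t4`, BINDER row NE9; filed by NE9 formalisation-swarm leaf prover 03
(`b2b-balaban-t4-ne9-formalise-leaf-03`, gen 75).  Imports this lineage's `B9Eq349ConjugatedProjectionDifferenceSqrtKappa` and ne9-leaf-06's
`B9Eq349ConjugatedDPChain` (proof pattern followed verbatim — CREDIT).  Sources READ first-hand: [Balaban1985BackgroundPropagators] p. 394 (3.21)∕(3.25),
p. 399 (3.49), p. 398 Thm 3.2 (3.48), p. 416 Thm 3.11.  The conjugation is the ROUTE's Combes–Thomas substitute; nothing of print's is asserted.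

WHAT IS PROVED (sorry-free; proof lane — no `def`; [folklore] composition BY NAME).  In the `+`∕`−` families of `B9Eq349ConjugatedDPChainLetters`:
* **`norm_conjRofU_sub_RofU_le_sqrtKappa`** — `‖S(R(U)(S⁻¹x)) − R(U)x‖ ≤ ((6 + 9)·β·s_A∕√κ₁)·‖x‖`.
HONEST SCOPE.  Symbolic composition; letters displayed as listed; no decay rate; ONE letter of ONE sub-step, NOT NE9 (cell pub-balaban: NE9 NOT PRINTED ∕ NOT
PROVED; «NE9 ⇐ the named binders»; row WALLED ON A MODEL (O-NE9-1; #5 UNRULED); spine PROVED 0∕9; rung (B)+1 on a finite T⁴ — NOT infinite volume, NOT mass gap,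
NOT BetaPertH, NOT Clay; HONEST DEPENDENCY: continuum YM on T⁴ ⇐ BetaPertH ∧ nine spine estimates (0/9 proved); BetaPertH ⇐ (D1) ∧ (D4) ∧ CAP+tail).  NEW
file; nothing modified.  Net new unproved facts: 0.
-/

noncomputable section

set_option autoImplicit false

open scoped InnerProductSpace ComplexConjugate

namespace Literature.MathematicalPhysics.QuantumFieldTheory.Balaban1983to89.B9Eq349ConjugatedProjectionDifferenceChain

open B4Sect5Torus (TSite)
open B9SectCLatticeCarrier (Bond bpos btgt)
open B9Eq311L2Pairing (WL2)
open B9Eq319QprimeTorus (fineP)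
open B11Eq103H1Complex (SiteL2K BondL2K greenK covDerivL2K)
open B7Prop1Explicit (U1)
open B9Eq310HessianOperator (adTransportW)
open B9Eq326OperatorAssembly (QprimeW RofU)
open B9Eq3119DeltaPiCarrier (laplacePrimeA GpOfU)
open B9Eq325ProjFormula (QGGQ_pos)
open B9Eq349ConjugatedProjectionChain (one_sub_RofU_apply_eq one_sub_RofU_fix inner_one_sub_RofU_left sq_mul_norm_sq_le_norm_GQ_sq)
open B9Eq311PointwiseMultipliers (exists_range_proj)
open B9Eq349ConjugatedRangeEnergy (adjoint_apply_adjoint_of_leftInverse)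
open B9Eq349ConjugatedDPChainLetters (S_Sinv Sinv_S SGinv_SG)
open B9Eq349ConjugatedDPChain (norm_Ap_sub_A_le norm_Am_sub_A_le)
open B9Eq349ConjugatedProjectionDifferenceSqrtKappa (norm_conjCompl_sub_compl_le)

variable {d : ℕ} {L : ℕ} [NeZero L] {m : Fin d → ℕ} {𝔸 : Type*} [NormedRing 𝔸] [NormedAlgebra ℂ 𝔸] [NormOneClass 𝔸]
  {W : Type*} [NormedAddCommGroup W] [InnerProductSpace ℂ W] [FiniteDimensional ℂ W] {φ : W ≃ₗ[ℂ] 𝔸} {Mφ Mφ' : ℝ}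
  (hφ : ∀ w, ‖φ w‖ ≤ Mφ * ‖w‖) (hφ' : ∀ X, ‖φ.symm X‖ ≤ Mφ' * ‖X‖) (hMφ : 0 ≤ Mφ) (hMφ' : 0 ≤ Mφ')
  {c₀ : ℝ} [Fact (0 < c₀)] {η : ℝ} (hη : 0 < η) {U : Bond d (fineP L m) → 𝔸ˣ} (hU : ∀ b, U b ∈ U1 𝔸) {εU : ℝ} (hεU : 0 ≤ εU)
  (hUε : ∀ b, ‖(U b : 𝔸) - 1‖ ≤ εU) {c₁ : ℝ} [Fact (0 < c₁)] (hc : c₁ = (L : ℝ) ^ d * c₀) {a' : ℝ} (ha' : 0 ≤ a')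
  (hRS : ∀ (b : Bond d (fineP L m)) (v u : W), ⟪adTransportW φ U b v, u⟫_ℂ = ⟪v, adTransportW φ (fun b => (U b)⁻¹) b u⟫_ℂ)
  (hpos' : ∀ x : SiteL2K ℂ d (fineP L m) c₀ W, x ≠ 0 → 0 < RCLike.re ⟪x, laplacePrimeA L m φ η U a' (c₁ := c₁) x⟫_ℂ)
  -- the conjugation: cut-offs and the six multipliers
  {κ : ℂ} {ℓ ℓ' : ℝ} (hℓ : 0 ≤ ℓ) (hℓ' : 0 ≤ ℓ') {χ : TSite d (fineP L m) → ℝ} {χ' : TSite d m → ℝ}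
  (hχ : ∀ b : Bond d (fineP L m), |χ (bpos b) - χ (btgt b)| ≤ ℓ * η)
  (hχ' : ∀ (y : TSite d m), ∀ x ∈ B9Eq319QprimeTorus.blockOf L m y, |χ' y - χ x| ≤ ℓ') (hwin : ‖κ‖ * ℓ * η ≤ 1) (hwin' : ‖κ‖ * ℓ' ≤ 1)
  {S Sinv : SiteL2K ℂ d (fineP L m) c₀ W →ₗ[ℂ] SiteL2K ℂ d (fineP L m) c₀ W}
  (hS : ∀ (f : SiteL2K ℂ d (fineP L m) c₀ W) (x : TSite d (fineP L m)),
    WL2.equiv ℂ (fun _ : TSite d (fineP L m) => c₀) W (S f) x = Complex.exp (κ * (χ x : ℂ)) • WL2.equiv ℂ (fun _ : TSite d (fineP L m) => c₀) W f x)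
  (hSinv : ∀ (f : SiteL2K ℂ d (fineP L m) c₀ W) (x : TSite d (fineP L m)),
    WL2.equiv ℂ (fun _ : TSite d (fineP L m) => c₀) W (Sinv f) x =
      Complex.exp (-(κ * (χ x : ℂ))) • WL2.equiv ℂ (fun _ : TSite d (fineP L m) => c₀) W f x)
  {SB SBinv : BondL2K ℂ d (fineP L m) c₀ W →ₗ[ℂ] BondL2K ℂ d (fineP L m) c₀ W}
  (hSB : ∀ (g : BondL2K ℂ d (fineP L m) c₀ W) (b : Bond d (fineP L m)),
    WL2.equiv ℂ (fun _ : Bond d (fineP L m) => c₀) W (SB g) b = Complex.exp (κ * (χ (bpos b) : ℂ)) • WL2.equiv ℂ (fun _ : Bond d (fineP L m) => c₀) W g b)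
  (hSBinv : ∀ (g : BondL2K ℂ d (fineP L m) c₀ W) (b : Bond d (fineP L m)),
    WL2.equiv ℂ (fun _ : Bond d (fineP L m) => c₀) W (SBinv g) b =
      Complex.exp (-(κ * (χ (bpos b) : ℂ))) • WL2.equiv ℂ (fun _ : Bond d (fineP L m) => c₀) W g b)
  {SG SGinv : SiteL2K ℂ d m c₁ W →ₗ[ℂ] SiteL2K ℂ d m c₁ W}
  (hSG : ∀ (g : SiteL2K ℂ d m c₁ W) (y : TSite d m),
    WL2.equiv ℂ (fun _ : TSite d m => c₁) W (SG g) y = Complex.exp (κ * (χ' y : ℂ)) • WL2.equiv ℂ (fun _ : TSite d m => c₁) W g y)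
  (hSGinv : ∀ (g : SiteL2K ℂ d m c₁ W) (y : TSite d m),
    WL2.equiv ℂ (fun _ : TSite d m => c₁) W (SGinv g) y = Complex.exp (-(κ * (χ' y : ℂ))) • WL2.equiv ℂ (fun _ : TSite d m => c₁) W g y)




include hφ hφ' hMφ hMφ' hη hU hεU hUε hc ha' hRS hℓ hℓ' hχ hχ' hwin hwin' hS hSinv hSB hSBinv hSG hSGinv in
/-- **`‖S R(U) S⁻¹ x − R(U)x‖ ≤ (15·β·s_A∕√κ₁)·‖x‖` FOR THE CHAIN** — `norm_conjCompl_sub_compl_le` with `R := R(U)`, `P := 1 − R(U)`, the four unconjugated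
letters by `B9Eq349ConjugatedProjectionChain` §1, `S^{−†} := (S⁻¹)†`, `A₊ = SAS_G⁻¹`, `A₋ = (S⁻¹)†AS_G†`, `δ± = β·s_A` by `norm_Ap_sub_A_le` ∕ `norm_Am_sub_A_le`,
`P_M`∕`P_N` by `exists_range_proj`, on the size window `12·s_A·β ≤ √κ₁` — the letter `dR` of `B9Eq326ConjugatedDeltaA.norm_conjG1ofU_le` with
`ρ = 15·β·s_A∕√κ₁` (`≤ 1∕8` once `120·s_A·β ≤ √κ₁`). [cite: Balaban1985BackgroundPropagators, (3.21) p.394, (3.25) p.394, (3.49) p.399, Thm 3.2 (3.48) p.398, Thm 3.11 p.416] -/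
theorem norm_conjRofU_sub_RofU_le_sqrtKappa {γ κ₁ M β : ℝ} (hγ : 0 < γ) (hγ1 : γ ≤ 1) (hκ₁ : 0 < κ₁) (hM : 0 ≤ M) (hβ : 0 ≤ β) (hβ1 : β ≤ 1)
    (coercive : ∀ f : SiteL2K ℂ d (fineP L m) c₀ W, γ * ‖f‖ ^ 2 ≤ ‖(covDerivL2K ℂ c₀ ((η : ℂ))⁻¹ (adTransportW φ U)) f‖ ^ 2 +
      a' * ‖((WL2.linearEquiv ℂ ℂ (fun _ : TSite d m => c₁)).symm.toLinearMap ∘ₗ QprimeW L m φ U (c₀ := c₀)) f‖ ^ 2)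
    (hκ : ∀ ψ : SiteL2K ℂ d m c₁ W, κ₁ * ‖ψ‖ ^ 2 ≤ RCLike.re ⟪ψ,
      (((WL2.linearEquiv ℂ ℂ (fun _ : TSite d m => c₁)).symm.toLinearMap ∘ₗ QprimeW L m φ U (c₀ := c₀)) ∘ₗ
        GpOfU L m φ η U a' (c₁ := c₁) hpos' ∘ₗ GpOfU L m φ η U a' (c₁ := c₁) hpos' ∘ₗ
        LinearMap.adjoint ((WL2.linearEquiv ℂ ℂ (fun _ : TSite d m => c₁)).symm.toLinearMap ∘ₗ QprimeW L m φ U (c₀ := c₀))) ψ⟫_ℂ)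
    (hMQ : ∀ s : SiteL2K ℂ d (fineP L m) c₀ W, ‖((WL2.linearEquiv ℂ ℂ (fun _ : TSite d m => c₁)).symm.toLinearMap ∘ₗ QprimeW L m φ U (c₀ := c₀)) s‖ ≤ M * ‖s‖)
    (hβD : 2 * ‖κ‖ * ℓ * (Mφ * Mφ') * Real.sqrt d ≤ β) (hβQ : 2 * ‖κ‖ * ℓ' * (1 + 2 * Mφ * Mφ' * εU) ^ (d * (L - 1)) ≤ β)
    (small : 3 * (1 + a') * β ^ 2 ≤ γ / 4) (hwinκ : 12 * (β * (4 / γ + M * ((4 / γ) ^ 2 * (3 + a' * (2 * M + 1))))) ≤ Real.sqrt κ₁)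
    (x : SiteL2K ℂ d (fineP L m) c₀ W) :
    ‖S (RofU L m φ η U (c₀ := c₀) (Sinv x)) - RofU L m φ η U (c₀ := c₀) x‖ ≤
      (6 * (β * (4 / γ + M * ((4 / γ) ^ 2 * (3 + a' * (2 * M + 1))))) + 9 * (β * (4 / γ + M * ((4 / γ) ^ 2 * (3 + a' * (2 * M + 1)))))) /
        Real.sqrt κ₁ * ‖x‖ := by
  obtain ⟨PM, Tp, hPAp, hfixp, hsap⟩ := exists_range_proj (𝕜 := ℂ) (S ∘ₗ (GpOfU L m φ η U a' (c₁ := c₁) hpos' ∘ₗ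
    LinearMap.adjoint ((WL2.linearEquiv ℂ ℂ (fun _ : TSite d m => c₁)).symm.toLinearMap ∘ₗ QprimeW L m φ U (c₀ := c₀))) ∘ₗ SGinv)
  obtain ⟨PN, Tm, hPAm, hfixm, hsam⟩ := exists_range_proj (𝕜 := ℂ) (LinearMap.adjoint Sinv ∘ₗ (GpOfU L m φ η U a' (c₁ := c₁) hpos' ∘ₗ
    LinearMap.adjoint ((WL2.linearEquiv ℂ ℂ (fun _ : TSite d m => c₁)).symm.toLinearMap ∘ₗ QprimeW L m φ U (c₀ := c₀))) ∘ₗ LinearMap.adjoint SG)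
  have hsA0 : 0 ≤ β * (4 / γ + M * ((4 / γ) ^ 2 * (3 + a' * (2 * M + 1)))) := by positivity
  have hdual : ∀ x y, ⟪LinearMap.adjoint Sinv x, S y⟫_ℂ = ⟪x, y⟫_ℂ := fun x y => by
    rw [LinearMap.adjoint_inner_left, Sinv_S hS hSinv]
  have hV : ∀ g, S ((GpOfU L m φ η U a' (c₁ := c₁) hpos' ∘ₗ LinearMap.adjoint ((WL2.linearEquiv ℂ ℂ (fun _ : TSite d m => c₁)).symm.toLinearMap ∘ₗ
      QprimeW L m φ U (c₀ := c₀))) g) = (S ∘ₗ (GpOfU L m φ η U a' (c₁ := c₁) hpos' ∘ₗ LinearMap.adjoint ((WL2.linearEquiv ℂ ℂ (fun _ : TSite d m => c₁)).symm.toLinearMap ∘ₗ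
      QprimeW L m φ U (c₀ := c₀))) ∘ₗ SGinv) (SG g) := fun g => by simp only [LinearMap.comp_apply, SGinv_SG hSG hSGinv]
  have hAm : ∀ h, (LinearMap.adjoint Sinv ∘ₗ (GpOfU L m φ η U a' (c₁ := c₁) hpos' ∘ₗ LinearMap.adjoint ((WL2.linearEquiv ℂ ℂ (fun _ : TSite d m => c₁)).symm.toLinearMap ∘ₗ
      QprimeW L m φ U (c₀ := c₀))) ∘ₗ LinearMap.adjoint SG) h = LinearMap.adjoint Sinv ((GpOfU L m φ η U a' (c₁ := c₁) hpos' ∘ₗ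
      LinearMap.adjoint ((WL2.linearEquiv ℂ ℂ (fun _ : TSite d m => c₁)).symm.toLinearMap ∘ₗ QprimeW L m φ U (c₀ := c₀))) (LinearMap.adjoint SG h)) := fun _ => rfl
  have h := norm_conjCompl_sub_compl_le (𝕜 := ℂ) (R := RofU L m φ η U (c₀ := c₀)) (P := LinearMap.id - RofU L m φ η U (c₀ := c₀))
    (A := GpOfU L m φ η U a' (c₁ := c₁) hpos' ∘ₗ
      LinearMap.adjoint ((WL2.linearEquiv ℂ ℂ (fun _ : TSite d m => c₁)).symm.toLinearMap ∘ₗ QprimeW L m φ U (c₀ := c₀)))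
    (T := fun f => greenK _ (QGGQ_pos L m φ c₀ η U c₁ a' hRS hpos')
      (((WL2.linearEquiv ℂ ℂ (fun _ : TSite d m => c₁)).symm.toLinearMap ∘ₗ QprimeW L m φ U (c₀ := c₀)) (GpOfU L m φ η U a' (c₁ := c₁) hpos' f)))
    (S := S) (Sinv := Sinv) (Sd := LinearMap.adjoint Sinv) (PM := PM) (PN := PN) (Tp := Tp) (Tm := Tm) (V := SG) (W' := LinearMap.adjoint SG)
    (fun x => by rw [LinearMap.sub_apply, LinearMap.id_apply, sub_sub_cancel])
    (fun f => by rw [LinearMap.sub_apply, LinearMap.id_apply]; exact one_sub_RofU_apply_eq L m φ c₀ η U c₁ a' hRS hpos' f)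
    (fun g => by rw [LinearMap.sub_apply, LinearMap.id_apply]; exact one_sub_RofU_fix L m φ c₀ η U c₁ a' hRS hpos' g)
    (fun x y => by rw [LinearMap.sub_apply, LinearMap.id_apply, LinearMap.sub_apply, LinearMap.id_apply]; exact inner_one_sub_RofU_left L m φ c₀ η U x y)
    hκ₁ (sq_mul_norm_sq_le_norm_GQ_sq L m φ c₀ η U c₁ a' hRS hpos' hκ) (S_Sinv hS hSinv) hdual hV hPAp hfixp hsap hsA0
    (norm_Ap_sub_A_le hφ hφ' hMφ hMφ' hη hU hεU hUε hc ha' hRS hpos' hℓ hℓ' hχ hχ' hwin hwin' hS hSinv hSB hSBinv hSG hSGinv hγ hγ1 hM hβ hβ1 coercive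
      hMQ hβD hβQ small)
    hwinκ hAm hPAm hfixm hsam hsA0
    (norm_Am_sub_A_le hφ hφ' hMφ hMφ' hη hU hεU hUε hc ha' hRS hpos' hℓ hℓ' hχ hχ' hwin hwin' hS hSinv hSB hSBinv hSG hSGinv hγ hγ1 hM hβ hβ1 coercive
      hMQ hβD hβQ small)
    hwinκ x
  exact h

end Literature.MathematicalPhysics.QuantumFieldTheory.Balaban1983to89.B9Eq349ConjugatedProjectionDifferenceChain

end
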